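/-
Copyright (c) 2026 the pub-hodgecm-mathlib formalisation cell (harness21).  Prover seat hodgecm-mathlib-K2E3-p06 (g2), Track B «K2-LIT» ∕ h413,
ENGINE E3 unit U4 «Keys», SIGS-TABLE row #6 `sig_K2E3IrregularReducibleCaseThree` — analytic letter hKP, brick F1 (Tate's Lemma 2.4.2 on the boundary `s = 0`).
-/
import Literature.NumberTheory.Automorphic.TateLocalFunctionalEquation   -- ★ Tate's local theory: `tateZeta`, `fourierSB`, Lemma 2.4.2 in the open strip
import Literature.NumberTheory.Automorphic.LocalFieldHaarBalls             -- ★ `LocalFieldHaar.isOpenEmbedding_unitsVal`, `range_unitsVal`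
import HarnessLib

/-!
# K2 · E3 · U4 «Keys», row #6 — brick F1: Tate's Lemma 2.4.2 `Z(f,χ,s)·Z(ĝ,χ⁻¹,1−s) = Z(f̂,χ⁻¹,1−s)·Z(g,χ,s)` UNDER INTEGRABILITY HYPOTHESES
# (in particular on the boundary `s = 0` of the strip, for a unitary `χ` and test functions vanishing near `0`) [Tate1950 §2.4 Lemma 2.4.2]

Cell `pub/hodgecm-mathlib` (D-0151), HCML Track B «K2-LIT», crux H413 = `stmt-HodgeConjecture-24833` (lane `--supports … --as helper`), route
HCCMUnconditional; socket `sig_K2E3IrregularReducibleCaseThree` (U4-c) of `Cruxes/H413/Lines/K2_E3_EllipticInputsSigs_U4Keys.lean`.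
THEOREMS ONLY (0 def ∕ 0 instance ∕ 0 notation ∕ 0 sorry); imports ★ `Literature.NumberTheory.Automorphic.TateLocalFunctionalEquation` ∕ `LocalFieldHaarBalls` only.

WHY.  Row #6 is ★ (p855477) modulo the analytic letter hKP «the skew-line integral `J(χ₁) = ∫_{E⁻} ‖1+η‖⁻¹ χ₁(1+η) dη` is non-zero for a character `χ₁` of
`E^×` trivial on norms and non-trivial on `F^×`» (Keys' Plancherel non-vanishing [Keys1984 §5]).  Seat g2 pays hKP by TATE'S FUBINI TRICK read at `s = 0`:
`J` is (a fibre of) the zeta integral `Z(g, χ₁, 0)` of a test function `g` on `E = L_w` that VANISHES NEAR `0`, so that `Z(g, χ₁, 0)` converges absolutely although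
`s = 0` is the boundary of Tate's strip `0 < re s < 1` for the unitary `χ₁`.  The ★ library proves Lemma 2.4.2 only in the open strip (where the integrability of
`f χ |·|^s` on `Fˣ` is automatic); this file re-runs Tate's shear-and-Fubini argument with that integrability as a HYPOTHESIS (`tateZeta_mul_tateZeta_fourierSB_comm_of_integrable`),
and discharges it for Schwartz–Bruhat functions vanishing on a ball `𝔭^n` (`integrable_tateZetaIntegrand_of_eq_zero_on_primePowBall`), every `s`.
* `tateZeta_mul_tateZeta_fourierSB_eq_integral_of_integrable` — the shear step `Z(f,χ,s) Z(ĝ,χ⁻¹,1−s) = ∫ (∫ f(x) ĝ(xy) |x| d×x) χ⁻¹(y)|y|^{1−s} d×y` from the integrability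
  of the two zeta integrands (★ proof of `tateZeta_mul_tateZeta_fourierSB_eq_integral`, hypotheses instead of the strip);
* **`tateZeta_mul_tateZeta_fourierSB_comm_of_integrable`** — Lemma 2.4.2 for `f, g ∈ 𝒮(F)`, `χ` of exponent `σ`, `re s < 1 − σ`, and `f χ |·|^s`, `g χ |·|^s` integrable on `Fˣ`
  (the symmetric inner integral is ★ `integral_mul_fourierSB_mul_normAbs_comm`, valid for all Schwartz–Bruhat `f, g`);
* `isCompact_preimage_unitsVal_of_subset`, **`integrable_tateZetaIntegrand_of_eq_zero_on_primePowBall`** — `f ∈ 𝒮(F)` with `f = 0` on `𝔭^n` has a zeta integrand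
  with compact support in `Fˣ`, hence integrable for EVERY `s` and every quasi-character;
* **`tateZeta_mul_tateZeta_fourierSB_comm_zero`** — the boundary case used by hKP: `χ` unitary (exponent `0`), `f, g ∈ 𝒮(F)` vanishing on balls around `0`, `s = 0`.
HONEST LABEL: HC_CM is proved only modulo the 7 printed citations (2 remaining named inputs: hLiu418 = `stmt-HodgeConjecture-24832`, h413 =
`stmt-HodgeConjecture-24833`) until rung 0 closes; count-neutral analytic plumbing (no socket paid here).

## References
* [Tate1950] J. Tate, *Fourier analysis in number fields and Hecke's zeta-functions* (1950), in Cassels–Fröhlich, *Algebraic Number Theory* (1967), Ch. XV,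
  §2.4 Lemma 2.4.2 (the shear `(α, β) ↦ (α, αβ)` and Fubini), Thm. 2.4.1.
* [Keys1984] D. Keys, *Principal series representations of special unitary groups over local fields*, Compositio Math. 51 (1984), §5 (Plancherel measure).
* [BushnellHenniart2006] C. J. Bushnell, G. Henniart, *The local Langlands conjecture for GL(2)* (2006), §23.4.
-/

set_option autoImplicit false
-- the mandated namespace has the single-problem summit's repeated segment (`HodgeConjecture.HodgeConjecture`)
set_option linter.dupNamespace false

noncomputable section

open scoped NNReal ENNReal Topology
open MeasureTheory Filter Set Function
open Literature.NumberTheory.GaloisRepresentations.IsNonarchimedeanLocalField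
open Literature.NumberTheory.Automorphic

namespace Summit.HodgeConjecture.HodgeConjecture.Cruxes.H413.K2E3TateZetaFubiniAtZero

variable {F : Type*} [Field F] [ValuativeRel F] [TopologicalSpace F] [IsNonarchimedeanLocalField F]
  [MeasurableSpace F] [BorelSpace F]

/-! ## §1 The shear step and Lemma 2.4.2 under integrability hypotheses -/

/-- **The shear step of Tate's Lemma 2.4.2, integrability as hypothesis**: if the zeta integrands `f(x) χ(x) |x|^s` and `ĝ(y) χ⁻¹(y) |y|^{1−s}` are integrable on `Fˣ`,
then `Z(f, χ, s) · Z(ĝ, χ⁻¹, 1−s) = ∫ (∫ f(x) ĝ(xy) |x| d×x) χ⁻¹(y) |y|^{1−s} d×y` (the shear `(x, y) ↦ (x, xy)` preserves `μ' ⊗ μ'`; Fubini).  The ★ library's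
`tateZeta_mul_tateZeta_fourierSB_eq_integral` is this statement with the integrability supplied by the strip `−σ < re s < 1 − σ`; the proof is the same.
[cite: Tate1950, §2.4, Lemma 2.4.2] -/
theorem tateZeta_mul_tateZeta_fourierSB_eq_integral_of_integrable (μ : Measure F) [μ.IsAddHaarMeasure]
    (μ' : Measure Fˣ) [μ'.IsHaarMeasure] (ψ : AddChar F Circle) (χ : QuasiChar F) (f g : F → ℂ) (s : ℂ)
    (hAi : Integrable (fun x : Fˣ => f (x : F) * ((χ x : ℂˣ) : ℂ) * (((normAbs F (x : F) : ℝ≥0) : ℝ) : ℂ) ^ s) μ')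
    (hBi : Integrable (fun y : Fˣ => fourierSB ψ μ g (y : F) * ((χ⁻¹ y : ℂˣ) : ℂ) *
      (((normAbs F (y : F) : ℝ≥0) : ℝ) : ℂ) ^ (1 - s)) μ') :
    tateZeta μ' f χ s * tateZeta μ' (fourierSB ψ μ g) χ⁻¹ (1 - s) =
      ∫ y : Fˣ, (∫ x : Fˣ, f (x : F) * fourierSB ψ μ g ((x : F) * y) *
          (((normAbs F (x : F) : ℝ≥0) : ℝ) : ℂ) ∂μ') *
        (((χ⁻¹ y : ℂˣ) : ℂ) * (((normAbs F (y : F) : ℝ≥0) : ℝ) : ℂ) ^ (1 - s)) ∂μ' := by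
  haveI : BorelSpace Fˣ := Units.borelSpace
  haveI : T2Space F := (Literature.NumberTheory.GaloisRepresentations.IsNonarchimedeanLocalField.isLocalField F).toT2Space
  haveI := secondCountableTopology_units F
  haveI := sigmaCompactSpace_units F
  set A : Fˣ → ℂ := fun x =>
    f (x : F) * ((χ x : ℂˣ) : ℂ) * (((normAbs F (x : F) : ℝ≥0) : ℝ) : ℂ) ^ s with hA
  set B : Fˣ → ℂ := fun y => fourierSB ψ μ g (y : F) * ((χ⁻¹ y : ℂˣ) : ℂ) *
    (((normAbs F (y : F) : ℝ≥0) : ℝ) : ℂ) ^ (1 - s) with hB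
  -- the product of the two zeta integrals as a double integral, then the shear
  have h1 : tateZeta μ' f χ s * tateZeta μ' (fourierSB ψ μ g) χ⁻¹ (1 - s) =
      ∫ z : Fˣ × Fˣ, A z.1 * B z.2 ∂(μ'.prod μ') := by
    rw [integral_prod_mul]
    rfl
  have hT : MeasurePreserving (MeasurableEquiv.shearMulRight Fˣ) (μ'.prod μ') (μ'.prod μ') :=
    measurePreserving_prod_mul μ' μ'
  have h2 : ∫ z : Fˣ × Fˣ, A z.1 * B (z.1 * z.2) ∂(μ'.prod μ') =
      ∫ z : Fˣ × Fˣ, A z.1 * B z.2 ∂(μ'.prod μ') :=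
    hT.integral_comp' (f := MeasurableEquiv.shearMulRight Fˣ) (fun z => A z.1 * B z.2)
  have hHi : Integrable (fun z : Fˣ × Fˣ => A z.1 * B (z.1 * z.2)) (μ'.prod μ') :=
    (hT.integrable_comp_emb (MeasurableEquiv.shearMulRight Fˣ).measurableEmbedding).2
      (hAi.mul_prod hBi)
  -- pointwise algebra on the sheared integrand
  have h3 : ∀ x y : Fˣ, A x * B (x * y) =
      f (x : F) * fourierSB ψ μ g ((x : F) * y) * (((normAbs F (x : F) : ℝ≥0) : ℝ) : ℂ) *
        (((χ⁻¹ y : ℂˣ) : ℂ) * (((normAbs F (y : F) : ℝ≥0) : ℝ) : ℂ) ^ (1 - s)) := by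
    intro x y
    have hx0 : (((normAbs F (x : F) : ℝ≥0) : ℝ) : ℂ) ≠ 0 := by
      exact_mod_cast normAbs_units_ne_zero x
    have hχ0 : ((χ x : ℂˣ) : ℂ) ≠ 0 := (χ x).ne_zero
    have hχ : ((χ⁻¹ (x * y) : ℂˣ) : ℂ) = ((χ x : ℂˣ) : ℂ)⁻¹ * ((χ⁻¹ y : ℂˣ) : ℂ) := by
      change (((χ (x * y))⁻¹ : ℂˣ) : ℂ) = ((χ x : ℂˣ) : ℂ)⁻¹ * (((χ y)⁻¹ : ℂˣ) : ℂ)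
      rw [map_mul, mul_inv, Units.val_mul, Units.val_inv_eq_inv_val, Units.val_inv_eq_inv_val]
    have hn : (((normAbs F ((x * y : Fˣ) : F) : ℝ≥0) : ℝ) : ℂ) ^ (1 - s) =
        (((normAbs F (x : F) : ℝ≥0) : ℝ) : ℂ) ^ (1 - s) *
          (((normAbs F (y : F) : ℝ≥0) : ℝ) : ℂ) ^ (1 - s) := by
      rw [Units.val_mul, map_mul, NNReal.coe_mul, Complex.ofReal_mul,
        Complex.mul_cpow_ofReal_nonneg (NNReal.coe_nonneg _) (NNReal.coe_nonneg _)]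
    have hpow : (((normAbs F (x : F) : ℝ≥0) : ℝ) : ℂ) ^ s *
        (((normAbs F (x : F) : ℝ≥0) : ℝ) : ℂ) ^ (1 - s) = (((normAbs F (x : F) : ℝ≥0) : ℝ) : ℂ) := by
      rw [← Complex.cpow_add _ _ hx0, add_sub_cancel, Complex.cpow_one]
    simp only [hA, hB]
    rw [hχ, hn, Units.val_mul]
    calc f (x : F) * ((χ x : ℂˣ) : ℂ) * (((normAbs F (x : F) : ℝ≥0) : ℝ) : ℂ) ^ s *
          (fourierSB ψ μ g ((x : F) * y) * (((χ x : ℂˣ) : ℂ)⁻¹ * ((χ⁻¹ y : ℂˣ) : ℂ)) *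
            ((((normAbs F (x : F) : ℝ≥0) : ℝ) : ℂ) ^ (1 - s) *
              (((normAbs F (y : F) : ℝ≥0) : ℝ) : ℂ) ^ (1 - s)))
        = f (x : F) * fourierSB ψ μ g ((x : F) * y) *
            ((((normAbs F (x : F) : ℝ≥0) : ℝ) : ℂ) ^ s *
              (((normAbs F (x : F) : ℝ≥0) : ℝ) : ℂ) ^ (1 - s)) *
            (((χ⁻¹ y : ℂˣ) : ℂ) * (((normAbs F (y : F) : ℝ≥0) : ℝ) : ℂ) ^ (1 - s)) *
            (((χ x : ℂˣ) : ℂ) * ((χ x : ℂˣ) : ℂ)⁻¹) := by ring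
      _ = _ := by rw [hpow, mul_inv_cancel₀ hχ0, mul_one]
  -- Fubini, integrating over `x` first
  rw [h1, ← h2, integral_prod_symm _ hHi]
  refine integral_congr_ae (ae_of_all _ fun y => ?_)
  dsimp only
  rw [← integral_mul_const]
  exact integral_congr_ae (ae_of_all _ fun x => h3 x y)

/-- **Tate's Lemma 2.4.2 under integrability hypotheses**: for `f, g ∈ 𝒮(F)`, `χ` of exponent `σ`, `re s < 1 − σ` (so that `f̂ χ⁻¹ |·|^{1−s}`, `ĝ χ⁻¹ |·|^{1−s}` are
integrable, ★ `integrable_tateZetaIntegrand`), and the two zeta integrands `f χ |·|^s`, `g χ |·|^s` INTEGRABLE on `Fˣ` (a hypothesis — automatic only for `re s > −σ`):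
`Z(f, χ, s) Z(ĝ, χ⁻¹, 1−s) = Z(f̂, χ⁻¹, 1−s) Z(g, χ, s)`.  Shear (above) + the symmetry of the inner integral ★ `integral_mul_fourierSB_mul_normAbs_comm`.
[cite: Tate1950, §2.4, Lemma 2.4.2] -/
theorem tateZeta_mul_tateZeta_fourierSB_comm_of_integrable (μ : Measure F) [μ.IsAddHaarMeasure]
    (μ' : Measure Fˣ) [μ'.IsHaarMeasure] {ψ : AddChar F Circle} (hψ : ψ.IsContinuousNontrivial)
    {χ : QuasiChar F} {σ : ℝ} (hσ : χ.HasExponent σ) {f g : F → ℂ} (hf : f ∈ SchwartzBruhat F)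
    (hg : g ∈ SchwartzBruhat F) {s : ℂ} (hs2 : s.re < 1 - σ)
    (hfi : Integrable (fun x : Fˣ => f (x : F) * ((χ x : ℂˣ) : ℂ) * (((normAbs F (x : F) : ℝ≥0) : ℝ) : ℂ) ^ s) μ')
    (hgi : Integrable (fun x : Fˣ => g (x : F) * ((χ x : ℂˣ) : ℂ) * (((normAbs F (x : F) : ℝ≥0) : ℝ) : ℂ) ^ s) μ') :
    tateZeta μ' f χ s * tateZeta μ' (fourierSB ψ μ g) χ⁻¹ (1 - s) =
      tateZeta μ' (fourierSB ψ μ f) χ⁻¹ (1 - s) * tateZeta μ' g χ s := by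
  have hBg : Integrable (fun y : Fˣ => fourierSB ψ μ g (y : F) * ((χ⁻¹ y : ℂˣ) : ℂ) *
      (((normAbs F (y : F) : ℝ≥0) : ℝ) : ℂ) ^ (1 - s)) μ' :=
    integrable_tateZetaIntegrand μ' (fourierSB_mem_schwartzBruhat μ hψ hg) hσ.inv
      (by rw [Complex.sub_re, Complex.one_re]; linarith)
  have hBf : Integrable (fun y : Fˣ => fourierSB ψ μ f (y : F) * ((χ⁻¹ y : ℂˣ) : ℂ) *
      (((normAbs F (y : F) : ℝ≥0) : ℝ) : ℂ) ^ (1 - s)) μ' :=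
    integrable_tateZetaIntegrand μ' (fourierSB_mem_schwartzBruhat μ hψ hf) hσ.inv
      (by rw [Complex.sub_re, Complex.one_re]; linarith)
  rw [tateZeta_mul_tateZeta_fourierSB_eq_integral_of_integrable μ μ' ψ χ f g s hfi hBg,
    mul_comm (tateZeta μ' (fourierSB ψ μ f) χ⁻¹ (1 - s)),
    tateZeta_mul_tateZeta_fourierSB_eq_integral_of_integrable μ μ' ψ χ g f s hgi hBf]
  refine integral_congr_ae (ae_of_all _ fun y => ?_)
  dsimp only
  rw [integral_mul_fourierSB_mul_normAbs_comm μ μ' hψ hf hg y]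

/-! ## §2 Test functions vanishing near `0`: the zeta integrand has compact support in `Fˣ` -/

omit [MeasurableSpace F] [BorelSpace F] in
/-- A compact `K ⊆ F ∖ {0}` pulls back to a compact subset of `Fˣ` (`Units.val` is an embedding). [folklore] -/
theorem isCompact_preimage_unitsVal_of_subset {K : Set F} (hK : IsCompact K) (hK0 : (0 : F) ∉ K) :
    IsCompact (((↑) : Fˣ → F) ⁻¹' K) := by
  haveI : T2Space F := (Literature.NumberTheory.GaloisRepresentations.IsNonarchimedeanLocalField.isLocalField F).toT2Space
  have himg : ((↑) : Fˣ → F) '' (((↑) : Fˣ → F) ⁻¹' K) = K := by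
    rw [Set.image_preimage_eq_inter_range, LocalFieldHaar.range_unitsVal]
    exact Set.inter_eq_left.2 fun x hx h0 => hK0 (by rw [Set.mem_singleton_iff] at h0; rwa [h0] at hx)
  exact (LocalFieldHaar.isOpenEmbedding_unitsVal (F := F)).isInducing.isCompact_iff.2 (by rw [himg]; exact hK)

omit [MeasurableSpace F] [BorelSpace F] in
/-- The zeta integrand `x ↦ f(x) χ(x) |x|^s` of a Schwartz–Bruhat `f` vanishing on the ball `𝔭^n` has COMPACT SUPPORT in `Fˣ` (inside the pull-back of `supp f ∖ 𝔭^n`).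
[cite: Tate1950, §2.4] -/
theorem hasCompactSupport_tateZetaIntegrand_of_eq_zero_on_primePowBall {f : F → ℂ} (hf : f ∈ SchwartzBruhat F)
    {n : ℤ} (hn : ∀ x ∈ primePowBall F n, f x = 0) (χ : QuasiChar F) (s : ℂ) :
    HasCompactSupport (fun x : Fˣ => f (x : F) * ((χ x : ℂˣ) : ℂ) * (((normAbs F (x : F) : ℝ≥0) : ℝ) : ℂ) ^ s) := by
  haveI : T2Space F := (Literature.NumberTheory.GaloisRepresentations.IsNonarchimedeanLocalField.isLocalField F).toT2Space
  obtain ⟨-, hcs⟩ := (mem_schwartzBruhat_iff).1 hf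
  set K : Set F := tsupport f ∩ (primePowBall F n)ᶜ with hKdef
  have hK : IsCompact K := hcs.inter_right (isOpen_primePowBall n).isClosed_compl
  have hK0 : (0 : F) ∉ K := fun h => h.2 (zero_mem_primePowBall n)
  refine HasCompactSupport.intro' (isCompact_preimage_unitsVal_of_subset hK hK0)
    ((hcs.isCompact.isClosed.inter (isOpen_primePowBall n).isClosed_compl).preimage Units.continuous_val) fun x hx => ?_
  have hx' : f (x : F) = 0 := by
    by_cases h1 : (x : F) ∈ primePowBall F n
    · exact hn _ h1
    · have h2 : (x : F) ∉ tsupport f := fun h2 => hx ⟨h2, h1⟩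
      exact image_eq_zero_of_notMem_tsupport h2
  rw [hx', zero_mul, zero_mul]

/-- **Integrability for every `s`** of the zeta integrand of a Schwartz–Bruhat `f` vanishing on a ball `𝔭^n`: it is continuous with compact support in `Fˣ`, for every
measure on `Fˣ` finite on compacts — no condition on `re s` (the boundary `s = 0` of Tate's strip included). [cite: Tate1950, §2.4] -/
theorem integrable_tateZetaIntegrand_of_eq_zero_on_primePowBall (μ' : Measure Fˣ) [IsFiniteMeasureOnCompacts μ']
    {f : F → ℂ} (hf : f ∈ SchwartzBruhat F) {n : ℤ} (hn : ∀ x ∈ primePowBall F n, f x = 0) (χ : QuasiChar F) (s : ℂ) :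
    Integrable (fun x : Fˣ => f (x : F) * ((χ x : ℂˣ) : ℂ) * (((normAbs F (x : F) : ℝ≥0) : ℝ) : ℂ) ^ s) μ' := by
  haveI : BorelSpace Fˣ := Units.borelSpace
  have hcont : Continuous (fun x : Fˣ => f (x : F) * ((χ x : ℂˣ) : ℂ) * (((normAbs F (x : F) : ℝ≥0) : ℝ) : ℂ) ^ s) :=
    (((continuous_of_mem_schwartzBruhat hf).comp Units.continuous_val).mul (continuous_quasiChar_coe χ)).mul
      (isLocallyConstant_normAbs_cpow s).continuous
  exact hcont.integrable_of_hasCompactSupport (hasCompactSupport_tateZetaIntegrand_of_eq_zero_on_primePowBall hf hn χ s)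

/-! ## §3 The boundary case `s = 0` for a unitary `χ` -/

/-- **Lemma 2.4.2 at `s = 0` for a unitary `χ` and test functions vanishing near `0`**: `Z(f, χ, 0) Z(ĝ, χ⁻¹, 1) = Z(f̂, χ⁻¹, 1) Z(g, χ, 0)` for `f, g ∈ 𝒮(F)` with
`f = 0` on `𝔭^{n}`, `g = 0` on `𝔭^{n'}`, `χ` of exponent `0`, `ψ` continuous non-trivial, `μ` additive Haar, `μ'` Haar on `Fˣ` — the form used for Keys' Plancherel
non-vanishing (hKP of row #6), where `g` carries the skew-line integral in its fibres. [cite: Tate1950, §2.4, Lemma 2.4.2] [cite: Keys1984, §5] -/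
theorem tateZeta_mul_tateZeta_fourierSB_comm_zero (μ : Measure F) [μ.IsAddHaarMeasure]
    (μ' : Measure Fˣ) [μ'.IsHaarMeasure] {ψ : AddChar F Circle} (hψ : ψ.IsContinuousNontrivial)
    {χ : QuasiChar F} (hχ : χ.HasExponent 0) {f g : F → ℂ} (hf : f ∈ SchwartzBruhat F) (hg : g ∈ SchwartzBruhat F)
    {n n' : ℤ} (hfn : ∀ x ∈ primePowBall F n, f x = 0) (hgn : ∀ x ∈ primePowBall F n', g x = 0) :
    tateZeta μ' f χ 0 * tateZeta μ' (fourierSB ψ μ g) χ⁻¹ 1 =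
      tateZeta μ' (fourierSB ψ μ f) χ⁻¹ 1 * tateZeta μ' g χ 0 := by
  have h := tateZeta_mul_tateZeta_fourierSB_comm_of_integrable μ μ' hψ hχ hf hg (s := 0) (by rw [Complex.zero_re]; norm_num)
    (integrable_tateZetaIntegrand_of_eq_zero_on_primePowBall μ' hf hfn χ 0)
    (integrable_tateZetaIntegrand_of_eq_zero_on_primePowBall μ' hg hgn χ 0)
  rwa [sub_zero] at h

end Summit.HodgeConjecture.HodgeConjecture.Cruxes.H413.K2E3TateZetaFubiniAtZero

end
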